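import Summits.NavierStokesRegularity.NavierStokesRegularity.Theorems.TypeIQuarterGateQuarterLawTypeIUniformLocalTypeI
import Summits.NavierStokesRegularity.NavierStokesRegularity.Theorems.TypeIQuarterGateQuarterLawTypeIWeakL3Count
import Summits.NavierStokesRegularity.NavierStokesRegularity.Theorems.StretchingWellBindingEnstrophyQuarterLawSmoothingEnvelope
import Literature.Analysis.FunctionSpaces.WeakLp
import HarnessLib

/-!
# `TypeIQuarterGate.QuarterLawTypeI` (crux stmt-NavierStokesRegularity-23726), line `lorentz-upgrade`:
# the stub `stub_lorentzCount` (= `LorentzCountTypeI`, stmt-24109) — LORENTZ BOUND ⇒ SCALE-UNIFORM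
# CONCENTRATION COUNT

`--supports stmt-NavierStokesRegularity-23726` (stub credit). Under the hypotheses of the crux plus a
uniform weak-`L³` bound `sup_{t<T} λ³|{|u(t)|>λ}| ≤ M'` on the slices, for every `η > 0` there are `N, r₀`
such that at every scale `r ≤ r₀` a `2r`-separated family of centres whose vertex-`T` cylinders
`B_r(x) × (T−r², T)` carry `∫∫ |∇u|_F² ≥ η r` has at most `N` members.

PROOF (tree theorems only).
1. Type I ⇒ uniform scale-`r₀` local energy bound (`CountQuarterLaw.uniformLocalTypeI_of_isTypeIBlowup`).
2. Localized smoothing (`EnstrophyQuarterLaw.SparseSieve.stub_smoothingEnvelope`, Barker–Prange 2020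
   Thm 1 / Kang–Miura–Tsai 2021): constants `γ, σ, C`; with `R = λ r`, `λ = max(4, 2/√σ, 3C/η + 1)`,
   smallness `∫_{B(x,2R)} |u(T − σR²)|³ ≤ γ³` would force `∫_{T−r²}^{T}∫_{B_r(x)} |∇u|_F² ≤ 3C r/λ < η r`;
   so every concentrating centre carries `∫_{B(x, 2λr)} |u(t₀)|³ > γ³` at the COMMON time
   `t₀ = T − σλ²r²`.
3. Counting at time `t₀` (`CountQuarterLaw.card_mul_le_of_weakL3_concentration`): the Type-I sup bound
   `|u(t₀)| ≤ B/√(T−t₀)` caps the number of dyadic levels above `λ₀ = γ/(2λr (2|B₁|)^{1/3})` by a constant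
   `K` independent of `r`, bounded overlap of the balls `B(xᵢ, 2λr)` (`2r`-separated centres) and the
   weak-`L³` bound at each level give `#σ ≤ 16 (K+1) (2λ+1)³ M'/γ³`.

HONEST FRAMING: a CONDITIONAL count along a HYPOTHETICAL Type-I blow-up with a hypothetical Lorentz bound;
`LorentzUpgradeTypeI` (24108: time-Type-I ⇒ Lorentz-Type-I) remains OPEN, and with it the crux
`QuarterLawTypeI`; nothing about Navier–Stokes regularity or blow-up is claimed.
[cite: BarkerPrange2020, Thm 1] [cite: AlbrittonBarker2019, Lemma 2.6]
-/

noncomputable section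

-- the summit-side namespace repeats a component by design (D-0017)
set_option linter.dupNamespace false

namespace Summit.NavierStokesRegularity.NavierStokesRegularity.Theorems.CountQuarterLaw

open Set MeasureTheory Function Metric Filter Topology
open scoped ENNReal NNReal
open Literature.Analysis.FluidPDE

set_option maxHeartbeats 400000 in
/-- **Registered stub `stub_lorentzCount` of the line `lorentz-upgrade` (crux `QuarterLawTypeI`,
stmt-23726), signature VERBATIM (= route item `LorentzCountTypeI`, stmt-24109): under the Type-I rate and a
uniform weak-`L³` bound on the slices, the scale-uniform ε-concentration count holds.**
[cite: BarkerPrange2020, Thm 1] [cite: AlbrittonBarker2019, Lemma 2.6] -/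
theorem stub_lorentzCount :
    ∀ (ν T : ℝ), 0 < ν → 0 < T → ∀ (u : ℝ → EuclideanSpace ℝ (Fin 3) → EuclideanSpace ℝ (Fin 3))
      (p : ℝ → EuclideanSpace ℝ (Fin 3) → ℝ),
      Literature.Analysis.FluidPDE.IsMaximalSmoothSolution ν 0 u p T →
      Literature.Analysis.FluidPDE.IsLerayHopfOn T ν 0 (u 0) u →
      Literature.Analysis.FluidPDE.HasRapidSpatialDecay (u 0) →
      Literature.Analysis.FluidPDE.IsTypeIBlowup u T →
      (∃ M' : ℝ, ∀ t ∈ Set.Ico 0 T,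
        Literature.Analysis.FunctionSpaces.eWeakLpPow (u t) 3 MeasureTheory.volume ≤ ENNReal.ofReal M') →
      (∀ η : ℝ, 0 < η → ∃ N : ℕ, ∃ r₀ : ℝ, 0 < r₀ ∧ ∀ r : ℝ, 0 < r → r ≤ r₀ →
        ∀ σ : Finset (EuclideanSpace ℝ (Fin 3)),
          (∀ x ∈ σ, ∀ x' ∈ σ, x ≠ x' → 2 * r ≤ ‖x - x'‖) →
          (∀ x ∈ σ, ENNReal.ofReal (η * r) ≤ ∫⁻ s in Set.Ioo (T - r ^ 2) T,
            ∫⁻ y in Metric.ball x r,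
              ENNReal.ofReal (Literature.Analysis.FluidPDE.frobeniusNormSq (fderiv ℝ (u s) y))) →
          σ.card ≤ N) := by
  intro ν T hν hT u p hmax hLH hdec hI hweak η hη
  classical
  have hsol : IsClassicalNSSolutionOn (Ico 0 T) ν 0 u p := hmax.1
  -- 1. uniform local energy (Type I)
  obtain ⟨M, r₀, hM, hr₀, hA, -⟩ := uniformLocalTypeI_of_isTypeIBlowup hν hT hsol hLH hdec hI
  -- 2. the smoothing envelope
  obtain ⟨γ, σs, C, hγ, hσs, hC, hsmooth⟩ :=
    EnstrophyQuarterLaw.SparseSieve.stub_smoothingEnvelope ν T hν hT u p hmax hLH hdec M r₀ hM hr₀ hA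
  -- the Type-I rate with a non-negative constant
  obtain ⟨CI, hCI⟩ := hI
  obtain ⟨tI, htIT, hIsub⟩ := mem_nhdsLT_iff_exists_Ioo_subset.1 hCI
  set tI' : ℝ := max tI 0 with htI'
  have htI'T : tI' < T := max_lt htIT hT
  have htI'0 : 0 ≤ tI' := le_max_right _ _
  set B : ℝ := max CI 0 with hB
  have hB0 : 0 ≤ B := le_max_right _ _
  have hrate : ∀ s ∈ Ioo tI' T, ∀ y, ‖u s y‖ ≤ B / Real.sqrt (T - s) := fun s hs y =>
    (hIsub ⟨lt_of_le_of_lt (le_max_left _ _) hs.1, hs.2⟩ y).trans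
      (div_le_div_of_nonneg_right (le_max_left _ _) (Real.sqrt_nonneg _))
  -- the weak-L³ bound with a non-negative constant
  obtain ⟨M', hM'⟩ := hweak
  set M'' : ℝ := max M' 0 with hM''
  have hM''0 : 0 ≤ M'' := le_max_right _ _
  -- the unit-ball volume and the cube root constant
  set V₁ : ℝ := (volume (ball (0 : EuclideanSpace ℝ (Fin 3)) 1)).toReal with hV₁
  have hV₁pos : 0 < V₁ := ENNReal.toReal_pos (measure_ball_pos volume _ one_pos).ne' measure_ball_lt_top.ne
  set cV : ℝ := (2 * V₁) ^ (1 / 3 : ℝ) with hcV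
  have hcVpos : 0 < cV := Real.rpow_pos_of_pos (by positivity) _
  have hcV3 : cV ^ 3 = 2 * V₁ := by
    rw [hcV, ← Real.rpow_natCast, ← Real.rpow_mul (by positivity)]
    norm_num
  -- the scale factor `λ`
  set lam : ℝ := max 4 (max (2 / Real.sqrt σs) (3 * C / η + 1)) with hlam
  have hlam4 : 4 ≤ lam := le_max_left _ _
  have hlampos : 0 < lam := lt_of_lt_of_le (by norm_num) hlam4
  have hlamσ : 2 / Real.sqrt σs ≤ lam := (le_max_left _ _).trans (le_max_right _ _)
  have hlamC : 3 * C / η + 1 ≤ lam := (le_max_right _ _).trans (le_max_right _ _)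
  have hσlam : 4 ≤ σs * lam ^ 2 := by
    have hsq : 0 < Real.sqrt σs := Real.sqrt_pos.2 hσs
    have h1 : 2 ≤ Real.sqrt σs * lam := by
      have := mul_le_mul_of_nonneg_left hlamσ hsq.le
      rwa [mul_div_cancel₀ _ hsq.ne'] at this
    have h2 := pow_le_pow_left₀ (by norm_num) h1 2
    rw [mul_pow, Real.sq_sqrt hσs.le] at h2
    linarith
  have hηlam : 3 * C < η * lam := by
    have h1 : η * (3 * C / η + 1) ≤ η * lam := mul_le_mul_of_nonneg_left hlamC hη.le
    rw [mul_add, mul_div_cancel₀ _ hη.ne', mul_one] at h1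
    linarith
  -- the number of dyadic levels
  set Q : ℝ := 2 * B * cV / (Real.sqrt σs * γ) with hQ
  have hQ0 : 0 ≤ Q := by rw [hQ]; positivity
  set K : ℕ := ⌈Q⌉₊ with hK
  have hQK : Q ≤ 2 ^ (K + 1) := by
    have h1 : Q ≤ K := Nat.le_ceil Q
    have h2 : (K : ℝ) < 2 ^ K := by exact_mod_cast Nat.lt_two_pow_self
    have h3 : (2 : ℝ) ^ K ≤ 2 ^ (K + 1) := pow_le_pow_right₀ (by norm_num) (Nat.le_succ _)
    linarith
  -- the bound `N` and the scale `r₀'`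
  set N : ℕ := ⌈16 * (K + 1) * (2 * lam + 1) ^ 3 * M'' / γ ^ 3⌉₊ with hN
  set rI : ℝ := Real.sqrt ((T - tI') / (σs * lam ^ 2)) / 2 with hrI
  have hσl : 0 < σs * lam ^ 2 := by positivity
  have hrIpos : 0 < rI := by rw [hrI]; exact div_pos (Real.sqrt_pos.2 (div_pos (by linarith) hσl)) two_pos
  have hrIsq : ∀ r : ℝ, 0 < r → r ≤ rI → σs * lam ^ 2 * r ^ 2 ≤ (T - tI') / 4 := by
    intro r hr hrle
    have h1 : r ^ 2 ≤ rI ^ 2 := pow_le_pow_left₀ hr.le hrle 2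
    have h2 : rI ^ 2 = (T - tI') / (σs * lam ^ 2) / 4 := by
      rw [hrI, div_pow, Real.sq_sqrt (div_pos (by linarith) hσl).le]; norm_num
    rw [h2] at h1
    have h3 := mul_le_mul_of_nonneg_left h1 hσl.le
    rw [show σs * lam ^ 2 * ((T - tI') / (σs * lam ^ 2) / 4) = (T - tI') / 4 by field_simp] at h3
    exact h3
  set r₁ : ℝ := min (r₀ / lam) rI with hr₁
  have hr₁pos : 0 < r₁ := lt_min (div_pos hr₀ hlampos) hrIpos
  refine ⟨N, r₁, hr₁pos, ?_⟩
  intro r hr hrr₁ σ hsep hconc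
  -- the scales at this `r`
  have hRr₀ : lam * r ≤ r₀ := by
    have h1 : r ≤ r₀ / lam := hrr₁.trans (min_le_left _ _)
    have := mul_le_mul_of_nonneg_left h1 hlampos.le
    rwa [mul_div_cancel₀ _ hlampos.ne'] at this
  have hrI' : σs * lam ^ 2 * r ^ 2 ≤ (T - tI') / 4 := hrIsq r hr (hrr₁.trans (min_le_right _ _))
  set R : ℝ := lam * r with hR
  have hRpos : 0 < R := mul_pos hlampos hr
  set t₀ : ℝ := T - σs * R ^ 2 with ht₀
  have hσR : σs * R ^ 2 = σs * lam ^ 2 * r ^ 2 := by rw [hR]; ring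
  have ht₀I : tI' < t₀ := by rw [ht₀, hσR]; linarith
  have ht₀T : t₀ < T := by rw [ht₀]; linarith [mul_pos hσs (pow_pos hRpos 2)]
  have ht₀0 : 0 ≤ t₀ := htI'0.trans ht₀I.le
  have hTt₀ : T - t₀ = σs * lam ^ 2 * r ^ 2 := by rw [ht₀, hσR]; ring
  -- 2'. every concentrating centre is NOT small at time `t₀` on `B(x, 2R)`
  have hbig : ∀ x ∈ σ, ENNReal.ofReal (γ ^ 3) < ∫⁻ y in ball x (2 * R), ‖u t₀ y‖ₑ ^ (3 : ℕ) := by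
    intro x hx
    by_contra hsmall
    rw [not_lt] at hsmall
    have ht₁ : T - r ^ 2 ∈ Ico (T - σs * R ^ 2 / 4) T := by
      refine ⟨?_, by nlinarith [hr]⟩
      rw [hσR]
      nlinarith [hσlam, pow_pos hr 2]
    have henv := hsmooth T R x hRpos hRr₀ (by rw [← ht₀]; exact ht₀0) le_rfl
      (by rw [← ht₀]; exact hsmall) (T - r ^ 2) ht₁
    rw [sub_sub_cancel] at henv
    -- compare with the concentration hypothesis
    have h3 : ∫⁻ s in Ioo (T - r ^ 2) T, ∫⁻ y in ball x r,
        ENNReal.ofReal (frobeniusNormSq (fderiv ℝ (u s) y)) ≤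
        3 * ∫⁻ s in Ioo (T - r ^ 2) T, ∫⁻ y in ball x (R / 4), ‖fderiv ℝ (u s) y‖ₑ ^ 2 := by
      rw [← lintegral_const_mul' _ _ (by norm_num)]
      refine lintegral_mono fun s => ?_
      rw [← lintegral_const_mul' _ _ (by norm_num)]
      have hsub : ball x r ⊆ ball x (R / 4) := by
        refine ball_subset_ball ?_
        have : 4 * r ≤ lam * r := mul_le_mul_of_nonneg_right hlam4 hr.le
        rw [hR]; linarith
      refine (lintegral_mono_set hsub).trans (lintegral_mono fun y => ?_)
      calc ENNReal.ofReal (frobeniusNormSq (fderiv ℝ (u s) y))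
          ≤ ENNReal.ofReal (3 * ‖fderiv ℝ (u s) y‖ ^ 2) :=
            ENNReal.ofReal_le_ofReal (frobeniusNormSq_le_three_mul _)
        _ = 3 * ‖fderiv ℝ (u s) y‖ₑ ^ 2 := by
            rw [ENNReal.ofReal_mul (by norm_num), ENNReal.ofReal_ofNat,
              ENNReal.ofReal_pow (norm_nonneg _), ofReal_norm]
    have h4 : ENNReal.ofReal (η * r) ≤ ENNReal.ofReal (3 * (C * r ^ 2 / R)) := by
      refine ((hconc x hx).trans h3).trans ?_
      rw [ENNReal.ofReal_mul (by norm_num : (0:ℝ) ≤ 3), ENNReal.ofReal_ofNat]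
      exact mul_le_mul' le_rfl henv
    rw [ENNReal.ofReal_le_ofReal_iff (by positivity)] at h4
    have e : 3 * (C * r ^ 2 / R) = (3 * C / lam) * r := by
      rw [hR, pow_two, ← mul_assoc, mul_div_mul_right _ _ hr.ne']
      ring
    rw [e] at h4
    have h5 : η ≤ 3 * C / lam := le_of_mul_le_mul_right h4 hr
    rw [le_div_iff₀ hlampos] at h5
    linarith
  -- 3. counting at time `t₀`
  have ht₀Ico : t₀ ∈ Ico 0 T := ⟨ht₀0, ht₀T⟩
  have hcont : Continuous (u t₀) := (hsol.contDiff_velocity ht₀Ico).continuous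
  set l0 : ℝ := γ / (2 * R * cV) with hl0
  have hl0pos : 0 < l0 := by rw [hl0]; positivity
  have hl0γ : l0 ^ 3 * ((2 * R) ^ 3 * V₁) = γ ^ 3 / 2 := by
    rw [hl0, div_pow, mul_pow, mul_pow, hcV3]
    field_simp
  set U : ℝ := Q * l0 with hU
  have hsqrt : Real.sqrt (T - t₀) = Real.sqrt σs * lam * r := by
    rw [hTt₀, show σs * lam ^ 2 * r ^ 2 = σs * (lam * r) ^ 2 by ring, Real.sqrt_mul hσs.le,
      Real.sqrt_sq (mul_pos hlampos hr).le, mul_assoc]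
  have hUeq : B / Real.sqrt (T - t₀) = U := by
    rw [hsqrt, hU, hQ, hl0, hR]
    field_simp
  have hbound : ∀ y, ‖u t₀ y‖ ≤ U := fun y => (hrate t₀ ⟨ht₀I, ht₀T⟩ y).trans hUeq.le
  have hKU : U ≤ 2 ^ (K + 1) * l0 := by
    rw [hU]; exact mul_le_mul_of_nonneg_right hQK hl0pos.le
  have hwk : ∀ t : ℝ≥0, (t : ℝ≥0∞) ^ (3 : ℝ) * volume {y | (t : ℝ≥0∞) < ‖u t₀ y‖ₑ} ≤
      ENNReal.ofReal M'' := by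
    intro t
    have h1 : (t : ℝ≥0∞) ^ (3 : ℝ≥0∞).toReal * volume {y | (t : ℝ≥0∞) < ‖u t₀ y‖ₑ} ≤
        ⨆ t' : ℝ≥0, (t' : ℝ≥0∞) ^ (3 : ℝ≥0∞).toReal * volume {y | (t' : ℝ≥0∞) < ‖u t₀ y‖ₑ} :=
      le_iSup (fun t' : ℝ≥0 => (t' : ℝ≥0∞) ^ (3 : ℝ≥0∞).toReal * volume {y | (t' : ℝ≥0∞) < ‖u t₀ y‖ₑ}) t
    have h2 : (⨆ t' : ℝ≥0, (t' : ℝ≥0∞) ^ (3 : ℝ≥0∞).toReal * volume {y | (t' : ℝ≥0∞) < ‖u t₀ y‖ₑ}) =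
        Literature.Analysis.FunctionSpaces.eWeakLpPow (u t₀) 3 volume := rfl
    rw [h2, ENNReal.toReal_ofNat] at h1
    exact h1.trans ((hM' t₀ ht₀Ico).trans (ENNReal.ofReal_le_ofReal (le_max_left _ _)))
  have hsep' : ∀ x ∈ σ, ∀ x' ∈ σ, x ≠ x' → 2 * r ≤ dist x x' := by
    intro x hx x' hx' hne; rw [dist_eq_norm]; exact hsep x hx x' hx' hne
  have hcount := card_mul_le_of_weakL3_concentration hcont hM''0 hγ hr (by positivity : (0:ℝ) < 2 * R)
    hl0pos hbound hwk hl0γ.le hKU σ hsep' hbig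
  -- `((2R + r)/r)³ = (2λ + 1)³`
  have e : (2 * R + r) / r = 2 * lam + 1 := by rw [hR]; field_simp
  rw [e] at hcount
  have hreal : (σ.card : ℝ) ≤ 16 * (K + 1) * (2 * lam + 1) ^ 3 * M'' / γ ^ 3 := by
    rw [le_div_iff₀ (pow_pos hγ 3)]
    calc (σ.card : ℝ) * γ ^ 3 = 2 * ((σ.card : ℝ) * (γ ^ 3 / 2)) := by ring
      _ ≤ 2 * (8 * (K + 1) * (2 * lam + 1) ^ 3 * M'') := mul_le_mul_of_nonneg_left hcount (by norm_num)
      _ = 16 * (K + 1) * (2 * lam + 1) ^ 3 * M'' := by ring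
  have hfinal : (σ.card : ℝ) ≤ (N : ℝ) := hreal.trans (by rw [hN]; exact Nat.le_ceil _)
  exact Nat.cast_le.1 hfinal

end Summit.NavierStokesRegularity.NavierStokesRegularity.Theorems.CountQuarterLaw

end
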